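import Mathlib
import HarnessLib
import Literature.MathematicalPhysics.QuantumLattice.GaugeGroupsProofs

/-!
# `U³ = 1` in `SU(3)` iff `U` is central or traceless: the elements of order dividing three are the centre `Z₃` and the single conjugacy class `tr U = 0` (eigenvalues `1, ω, ω²`)

HONEST FRAMING: exact (Metropolis-corrected) sampling algorithms for lattice gauge theory;
figures of merit are autocorrelation/cost numbers at stated couplings and volumes; no
continuum-physics claim.

Venture `LatticeQCDFlow` (cell pub-lqcd), sub-topic `Scoring`; FANOUT row 21 (`su3-base`: the 4D
`SU(3)` baselines).  NEW WORK of the cell (placement rule), elementary, over the Literature file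
`QuantumLattice/GaugeGroupsProofs` (`exists_conj_eq_diagonal`, Bröcker–tom Dieck IV (3.1)); no
definition is introduced; nothing is cited as a fact; no number of ours.  Part of row 21's `SU(3)`
structure series (`SU3TraceLowerBound`: `Re tr ≥ −3/2`, `= −3/2` iff non-trivial centre;
`SU3TraceModulusCentre`: `|tr| = 3` iff centre; `SU3ConjugacyByTrace`: the trace decides the class;
`SU3TraceDeltoid`: the trace lies in the deltoid).  Here: the point `t = 0` of the deltoid.

For unimodular `a, b, c` with `abc = 1`: if `a + b + c = 0` then also
`ab + ac + bc = conj(a + b + c) = 0`, so `(X − a)(X − b)(X − c) = X³ − 1`: each of `a, b, c` is a cube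
root of unity, and they are pairwise DISTINCT (if `a = b` then `|c| = |−2a| = 2`).  Conversely three
cube roots of unity with product `1` are either all equal (`a = b = c = ζ`) or pairwise distinct with
sum `0` (`a³ = b³`, `a ≠ b ⟹ a² + ab + b² = 0`, and two such relations give `(b − c)(a + b + c) = 0`).
On `SU(3)` (diagonalise): **`U³ = 1 ⟺ tr U = 0 ∨ U = ζ·1 (ζ³ = 1)`**, and `tr U = 0 ⟹ U³ = 1` with
three distinct eigenvalues `{1, ω, ω²}`.

## What is proved

* §1 `cube_eq_one_of_sum_eq_zero` (unimodular, `abc = 1`, `a + b + c = 0` ⟹ `a³ = 1`; and `b³`,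
  `c³` by symmetry), `pairwise_ne_of_sum_eq_zero`, `sum_eq_zero_or_all_eq_of_cubes`
  (`a³ = b³ = c³ = 1`, `abc = 1` ⟹ `a + b + c = 0 ∨ (a = b ∧ a = c)`).
* §2 (`SU(3)`) **`su3_pow_three_eq_one_of_trace_eq_zero`** (`tr U = 0 ⟹ U³ = 1`),
  **`su3_pow_three_eq_one_iff`** (`U³ = 1 ⟺ tr U = 0 ∨ ∃ ζ, ζ³ = 1 ∧ U = ζ·1`),
  `su3_trace_eq_zero_not_central` (a traceless element is not central).

NOT CLAIMED: anything about centre sectors / vortices in the Wilson ensemble; the explicit conjugating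
matrix to `diag(1, ω, ω²)` (that tracelessness fixes the conjugacy class is
`Scoring/SU3ConjugacyByTrace.su3_isConj_iff_trace_eq`).
-/

namespace Summit.Ventures.LatticeQCDFlow.Scoring

open Matrix Complex
open Literature.MathematicalPhysics.QuantumLattice

/-! ## §1 Three unimodular numbers with product one and sum zero -/

/-- If `a, b` are unimodular, `abc = 1` and `a + b + c = 0`, then `a³ = 1` (Vieta: the elementary
symmetric functions are `0, 0, 1`, so `a` is a root of `X³ − 1`). -/
theorem cube_eq_one_of_sum_eq_zero {a b c : ℂ} (ha : ‖a‖ = 1) (hb : ‖b‖ = 1) (habc : a * b * c = 1)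
    (hsum : a + b + c = 0) : a ^ 3 = 1 := by
  -- conjugates: `conj a = b c`, `conj b = a c`, `conj c = a b`
  have hc : ‖c‖ = 1 := by
    have h := congrArg norm habc
    rw [norm_mul, norm_mul, ha, hb, one_mul, one_mul, norm_one] at h
    exact h
  have hca : (starRingEnd ℂ) a = b * c := by
    rw [← inv_eq_conj_of_norm_eq_one ha]
    exact inv_eq_of_mul_eq_one_right (by rw [← mul_assoc]; exact habc)
  have hcb : (starRingEnd ℂ) b = a * c := by
    rw [← inv_eq_conj_of_norm_eq_one hb]
    exact inv_eq_of_mul_eq_one_right (by linear_combination habc)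
  have hcc : (starRingEnd ℂ) c = a * b := by
    rw [← inv_eq_conj_of_norm_eq_one hc]
    exact inv_eq_of_mul_eq_one_right (by linear_combination habc)
  have he2 : a * b + a * c + b * c = 0 := by
    have h := congrArg (starRingEnd ℂ) hsum
    rw [map_add, map_add, hca, hcb, hcc, map_zero] at h
    linear_combination h
  -- `a³ − 1 = a³ − e₁ a² + e₂ a − e₃ = (a − a)(a − b)(a − c) = 0`
  linear_combination (a ^ 2) * hsum - a * he2 + habc

/-- With sum zero the three numbers are pairwise distinct (if `a = b` then `|c| = 2`). -/
theorem pairwise_ne_of_sum_eq_zero {a b c : ℂ} (ha : ‖a‖ = 1) (hb : ‖b‖ = 1) (hc : ‖c‖ = 1)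
    (hsum : a + b + c = 0) : a ≠ b ∧ a ≠ c ∧ b ≠ c := by
  refine ⟨fun h => ?_, fun h => ?_, fun h => ?_⟩
  · have hc2 : c = -(2 * a) := by rw [← h] at hsum; linear_combination hsum
    have : ‖c‖ = 2 := by rw [hc2, norm_neg, norm_mul, ha]; simp
    rw [hc] at this; norm_num at this
  · have hb2 : b = -(2 * a) := by rw [← h] at hsum; linear_combination hsum
    have : ‖b‖ = 2 := by rw [hb2, norm_neg, norm_mul, ha]; simp
    rw [hb] at this; norm_num at this
  · have ha2 : a = -(2 * b) := by rw [← h] at hsum; linear_combination hsum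
    have : ‖a‖ = 2 := by rw [ha2, norm_neg, norm_mul, hb]; simp
    rw [ha] at this; norm_num at this

/-- Three cube roots of unity with product one are either pairwise distinct with sum zero or all
equal. -/
theorem sum_eq_zero_or_all_eq_of_cubes {a b c : ℂ} (ha3 : a ^ 3 = 1) (hb3 : b ^ 3 = 1)
    (hc3 : c ^ 3 = 1) (habc : a * b * c = 1) : a + b + c = 0 ∨ (a = b ∧ a = c) := by
  by_cases hab : a = b
  · -- `a = b`: then `c = 1/a² = a` (as `a³ = 1`), all equal
    right
    refine ⟨hab, ?_⟩
    subst hab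
    -- `a * a * c = 1` and `a³ = 1` ⇒ `c = a`
    have : a * (a * a * c) = a * 1 := by rw [habc]
    have h2 : a ^ 3 * c = a := by linear_combination this
    rw [ha3, one_mul] at h2
    exact h2.symm
  · left
    -- `a³ = b³`, `a ≠ b` ⇒ `a² + ab + b² = 0`
    have hq : ∀ x y : ℂ, x ^ 3 = 1 → y ^ 3 = 1 → x ≠ y → x ^ 2 + x * y + y ^ 2 = 0 := by
      intro x y hx hy hxy
      have h : (x - y) * (x ^ 2 + x * y + y ^ 2) = 0 := by
        linear_combination hx - hy
      exact (mul_eq_zero.mp h).resolve_left (sub_ne_zero.mpr hxy)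
    have h1 := hq a b ha3 hb3 hab
    by_cases hac : a = c
    · -- then `b = 1/(a c) = 1/a² = a`, contradicting `a ≠ b`
      exfalso
      subst hac
      have : a * (a * b * a) = a * 1 := by rw [habc]
      have h2 : a ^ 3 * b = a := by linear_combination this
      rw [ha3, one_mul] at h2
      exact hab h2.symm
    · have h2 := hq a c ha3 hc3 hac
      -- subtract: `(b − c)(a + b + c) = 0`
      have h3 : (b - c) * (a + b + c) = 0 := by linear_combination h1 - h2
      rcases mul_eq_zero.mp h3 with h | h
      · -- `b = c` ⇒ `a = 1/b² = b`, contradiction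
        exfalso
        have hbc : b = c := sub_eq_zero.mp h
        subst hbc
        have : b * (a * b * b) = b * 1 := by rw [habc]
        have h4 : b ^ 3 * a = b := by linear_combination this
        rw [hb3, one_mul] at h4
        exact hab h4
      · exact h

/-! ## §2 `SU(3)`: order three -/

section SpecialUnitaryThree

/-- **A traceless `SU(3)` matrix has order dividing three: `tr U = 0 ⟹ U³ = 1`** (its eigenvalues
are the three distinct cube roots of unity). -/
theorem su3_pow_three_eq_one_of_trace_eq_zero (U : Matrix.specialUnitaryGroup (Fin 3) ℂ)
    (h : (U : Matrix (Fin 3) (Fin 3) ℂ).trace = 0) : U ^ 3 = 1 := by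
  obtain ⟨u, D, d, hD, hU⟩ := exists_conj_eq_diagonal U
  have h1 := norm_eq_one_of_coe_eq_diagonal hD
  have hp := prod_eq_one_of_coe_eq_diagonal hD
  rw [Fin.prod_univ_three] at hp
  have htr : (U : Matrix (Fin 3) (Fin 3) ℂ).trace = d 0 + d 1 + d 2 := by
    rw [hU]
    change ((u : Matrix (Fin 3) (Fin 3) ℂ) * (D : Matrix (Fin 3) (Fin 3) ℂ) *
        star (u : Matrix (Fin 3) (Fin 3) ℂ)).trace = _
    rw [Matrix.trace_mul_cycle, Unitary.star_mul_self_of_mem u.2.1, Matrix.one_mul, hD,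
      trace_diagonal, Fin.sum_univ_three]
  rw [htr] at h
  have hd0 : d 0 ^ 3 = 1 := cube_eq_one_of_sum_eq_zero (h1 0) (h1 1) hp h
  have hd1 : d 1 ^ 3 = 1 :=
    cube_eq_one_of_sum_eq_zero (c := d 0) (h1 1) (h1 2) (by linear_combination hp)
      (by linear_combination h)
  have hd2 : d 2 ^ 3 = 1 :=
    cube_eq_one_of_sum_eq_zero (c := d 1) (h1 2) (h1 0) (by linear_combination hp)
      (by linear_combination h)
  -- `D³ = 1`, hence `U³ = u D³ u⁻¹ = 1`
  have hD3 : D ^ 3 = 1 := by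
    apply Subtype.ext
    change ((D ^ 3 : Matrix.specialUnitaryGroup (Fin 3) ℂ) : Matrix (Fin 3) (Fin 3) ℂ) = 1
    rw [SubmonoidClass.coe_pow, hD, diagonal_pow]
    have hd : d ^ 3 = fun _ => 1 := by
      funext i; fin_cases i
      · exact hd0
      · exact hd1
      · exact hd2
    rw [hd, diagonal_one]
  rw [hU, conj_pow, hD3, mul_one, mul_inv_cancel]

/-- A traceless `SU(3)` matrix is not central (central elements have `|tr| = 3`). -/
theorem su3_trace_eq_zero_not_central (U : Matrix.specialUnitaryGroup (Fin 3) ℂ)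
    (h : (U : Matrix (Fin 3) (Fin 3) ℂ).trace = 0) :
    ¬ ∃ ζ : ℂ, ζ ^ 3 = 1 ∧ (U : Matrix (Fin 3) (Fin 3) ℂ) = ζ • (1 : Matrix (Fin 3) (Fin 3) ℂ) := by
  rintro ⟨ζ, h3, hU⟩
  rw [hU, Matrix.trace_smul, Matrix.trace_one, Fintype.card_fin, smul_eq_mul] at h
  have hζ : ζ = 0 := by
    have : ζ * 3 = 0 := by exact_mod_cast h
    simpa using this
  rw [hζ] at h3
  norm_num at h3

/-- **`U³ = 1` in `SU(3)` iff `U` is traceless or central.** -/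
theorem su3_pow_three_eq_one_iff (U : Matrix.specialUnitaryGroup (Fin 3) ℂ) :
    U ^ 3 = 1 ↔ (U : Matrix (Fin 3) (Fin 3) ℂ).trace = 0 ∨
      ∃ ζ : ℂ, ζ ^ 3 = 1 ∧ (U : Matrix (Fin 3) (Fin 3) ℂ) = ζ • (1 : Matrix (Fin 3) (Fin 3) ℂ) := by
  constructor
  · intro h3
    obtain ⟨u, D, d, hD, hU⟩ := exists_conj_eq_diagonal U
    have hp := prod_eq_one_of_coe_eq_diagonal hD
    rw [Fin.prod_univ_three] at hp
    have htr : (U : Matrix (Fin 3) (Fin 3) ℂ).trace = d 0 + d 1 + d 2 := by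
      rw [hU]
      change ((u : Matrix (Fin 3) (Fin 3) ℂ) * (D : Matrix (Fin 3) (Fin 3) ℂ) *
          star (u : Matrix (Fin 3) (Fin 3) ℂ)).trace = _
      rw [Matrix.trace_mul_cycle, Unitary.star_mul_self_of_mem u.2.1, Matrix.one_mul, hD,
        trace_diagonal, Fin.sum_univ_three]
    -- `D³ = u⁻¹ U³ u = 1`, so each `dᵢ³ = 1`
    have hD3 : D ^ 3 = 1 := by
      have hDU : D = u⁻¹ * U * u⁻¹⁻¹ := by rw [inv_inv, hU]; group
      rw [hDU, conj_pow, h3, mul_one, inv_inv, inv_mul_cancel]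
    have hM : (diagonal d) ^ 3 = (1 : Matrix (Fin 3) (Fin 3) ℂ) := by
      rw [← hD, ← SubmonoidClass.coe_pow, hD3]; rfl
    have hd3 : ∀ i, d i ^ 3 = 1 := by
      intro i
      have h := congrFun (congrFun hM i) i
      rw [diagonal_pow, diagonal_apply_eq, Pi.pow_apply, Matrix.one_apply_eq] at h
      exact h
    rcases sum_eq_zero_or_all_eq_of_cubes (hd3 0) (hd3 1) (hd3 2) hp with hs | ⟨h01, h02⟩
    · left; rw [htr, hs]
    · right
      refine ⟨d 0, hd3 0, ?_⟩
      have hd : d = fun _ => d 0 := by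
        funext i; fin_cases i
        · rfl
        · exact h01.symm
        · exact h02.symm
      have hDm : (D : Matrix (Fin 3) (Fin 3) ℂ) = d 0 • (1 : Matrix (Fin 3) (Fin 3) ℂ) := by
        rw [hD, hd, smul_one_eq_diagonal]
      rw [hU]
      change (u : Matrix (Fin 3) (Fin 3) ℂ) * (D : Matrix (Fin 3) (Fin 3) ℂ) *
          star (u : Matrix (Fin 3) (Fin 3) ℂ) = _
      rw [hDm, Matrix.mul_smul, Matrix.mul_one, Matrix.smul_mul, Unitary.mul_star_self_of_mem u.2.1]
  · rintro (h | ⟨ζ, h3, hU⟩)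
    · exact su3_pow_three_eq_one_of_trace_eq_zero U h
    · apply Subtype.ext
      change ((U ^ 3 : Matrix.specialUnitaryGroup (Fin 3) ℂ) : Matrix (Fin 3) (Fin 3) ℂ) = 1
      rw [SubmonoidClass.coe_pow, hU, smul_pow, one_pow, h3, one_smul]

end SpecialUnitaryThree

end Summit.Ventures.LatticeQCDFlow.Scoring
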